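import Summits.AtomisticToContinuum.FouriersLaw.Theorems.ParityLiouvilleSeedLiouvilleForHeatHarmonicRegularity
import Summits.AtomisticToContinuum.FouriersLaw.Theorems.ParityLiouvilleSeedLiouvilleForHeatHarmonicTimeInvariance

/-!
# The harmonic tightness witness: anharmonicity cannot be dropped from `LiouvilleForHeat`

Support file (`--supports stmt-AtomisticToContinuum-13980`, route `ParityLiouvilleSeed`, decl
`Summit.AtomisticToContinuum.FouriersLaw.Theses.ParityLiouvilleSeed.LiouvilleForHeat`; equally for
the crux `ZeroCurrentRigidity`, `stmt-AtomisticToContinuum-12073`).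

Both route statements quantify over `ω₂ > 0`, `lam > 0`, `β > 0` and assert that every probability
measure of the infinite pinned chain which is time invariant (generator sense), translation bounded
(resp. shift invariant) and REGULAR (box relative entropies `≤ C(n+1)` w.r.t. one shift-invariant
Gibbs state), with `j₀ ∈ L¹`, has `∫ j₀ = 0`. Their docstrings record "false for the harmonic chain
(Spohn–Lebowitz 1977)". This file PROVES that remark inside the tree's vocabulary, with an explicit,
elementary, finite-range witness:

* `harmonic_witness` — for every `ω₂ > 0` and `γ`, the radiating Gaussian state
  `harmonicState ω₂` (`…HarmonicDefs`) of the HARMONIC chain `pinnedChain ω₂ 0 0 γ` is a probability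
  measure which is shift invariant, time invariant (`…HarmonicTimeInvariance`), translation bounded,
  regular w.r.t. a shift-invariant Gibbs state at `T = 1` (`…HarmonicRegularity`), has `j₀ ∈ L¹` and
  mean current `∫ j₀ = -1/2 ≠ 0` (`…HarmonicCurrent`);
* `liouvilleForHeat_false_at_harmonic` — the statement of `LiouvilleForHeat` with the hypotheses
  `0 < lam`, `0 < β` RELAXED to `0 ≤ lam`, `0 ≤ β` is false;
* `zeroCurrentRigidity_false_at_harmonic` — the same for `ZeroCurrentRigidity`.

Together with `liouvilleForHeat_false_without_regularity` (`…RadiatingWave`: regularity cannot be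
dropped even at `lam = 4β > 0`), this pins down what any proof of either item must use: BOTH the
regularity of the state AND the anharmonicity of the chain (`lam > 0` or `β > 0`) — the harmonic
chain carries regular, space-time invariant, translation-bounded, current-carrying states.
-/

noncomputable section

open MeasureTheory ProbabilityTheory InformationTheory
open scoped NNReal ENNReal
open Literature.MathematicalPhysics.KineticTheory.HeatConduction

namespace Summit.AtomisticToContinuum.FouriersLaw.Theorems.ParityLiouvilleSeed

open HarmonicWitness

/-- **The harmonic tightness witness.** For `ω₂ > 0` and any bath coupling `γ`, the radiating
Gaussian state of the harmonic pinned chain `pinnedChain ω₂ 0 0 γ` is a shift-invariant,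
time-invariant, translation-bounded, REGULAR probability measure with integrable bond current of
mean `-1/2`. [folklore] -/
theorem harmonic_witness (ω₂ γ : ℝ) (hω : 0 < ω₂) :
    ∃ ν : Measure ChainConfig, IsProbabilityMeasure ν ∧ IsShiftInvariant ν ∧
      IsTimeInvariant (pinnedChain ω₂ 0 0 γ) ν ∧
      (∀ m : ℕ, ∃ C : ℝ, ∀ x : ℤ,
        Integrable (fun σ : ChainConfig => |(σ x).1| ^ m + |(σ x).2| ^ m) ν ∧
          ∫ σ, (|(σ x).1| ^ m + |(σ x).2| ^ m) ∂ν ≤ C) ∧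
      (∃ (T : ℝ) (μT : Measure ChainConfig), 0 < T ∧ (pinnedChain ω₂ 0 0 γ).IsChainGibbsMeasure T μT ∧
        IsShiftInvariant μT ∧ ∃ C : ℝ≥0∞, C ≠ ⊤ ∧ ∀ (a : ℤ) (n : ℕ),
          klDiv (boxMarginal a n ν) (boxMarginal a n μT) ≤ C * (n + 1)) ∧
      IsRegular (pinnedChain ω₂ 0 0 γ) ν ∧
      Integrable (fun σ => (pinnedChain ω₂ 0 0 γ).bondCurrentZ σ 0) ν ∧
      ∫ σ, (pinnedChain ω₂ 0 0 γ).bondCurrentZ σ 0 ∂ν = -(1 / 2) := by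
  obtain ⟨μ, hG, hS, C, hC, hKL⟩ := regular_harmonicState ω₂ hω γ
  exact ⟨harmonicState ω₂, inferInstance, isShiftInvariant_harmonicState ω₂,
    isTimeInvariant_harmonicState ω₂ hω γ, moments_harmonicState ω₂,
    ⟨1, μ, one_pos, hG, hS, C, hC, hKL⟩, ⟨1, μ, one_pos, hG, C, hC, hKL⟩,
    integrable_bondCurrentZ_harmonicState ω₂ γ, integral_bondCurrentZ_harmonicState ω₂ γ⟩

/-- **`LiouvilleForHeat` is false at the harmonic point.** The statement of the route decl
`Summit.AtomisticToContinuum.FouriersLaw.Theses.ParityLiouvilleSeed.LiouvilleForHeat` with its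
hypotheses `0 < lam`, `0 < β` relaxed to `0 ≤ lam`, `0 ≤ β` fails: at `lam = β = 0` the radiating
Gaussian state of `harmonic_witness` is a time-invariant, translation-bounded, regular state with
`∫ j₀ = -1/2`. Hence the anharmonicity hypotheses of `LiouvilleForHeat` are load-bearing (and, by
`liouvilleForHeat_false_without_regularity`, so is regularity). [folklore] -/
theorem liouvilleForHeat_false_at_harmonic :
    ¬ (∀ ω₂ lam β γ : ℝ, 0 < ω₂ → 0 ≤ lam → 0 ≤ β → ∀ ν : Measure ChainConfig,
        IsProbabilityMeasure ν → IsTimeInvariant (pinnedChain ω₂ lam β γ) ν →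
        (∀ m : ℕ, ∃ C : ℝ, ∀ x : ℤ,
          Integrable (fun σ : ChainConfig => |(σ x).1| ^ m + |(σ x).2| ^ m) ν ∧
            ∫ σ, (|(σ x).1| ^ m + |(σ x).2| ^ m) ∂ν ≤ C) →
        (∃ (T : ℝ) (μT : Measure ChainConfig), 0 < T ∧ (pinnedChain ω₂ lam β γ).IsChainGibbsMeasure T μT ∧
          IsShiftInvariant μT ∧ ∃ C : ℝ≥0∞, C ≠ ⊤ ∧ ∀ (a : ℤ) (n : ℕ),
            klDiv (boxMarginal a n ν) (boxMarginal a n μT) ≤ C * (n + 1)) →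
        Integrable (fun σ => (pinnedChain ω₂ lam β γ).bondCurrentZ σ 0) ν →
        ∫ σ, (pinnedChain ω₂ lam β γ).bondCurrentZ σ 0 ∂ν = 0) := by
  intro h
  obtain ⟨ν, hν, -, hT, hM, hReg, -, hI, hJ⟩ := harmonic_witness 1 0 one_pos
  have h0 := h 1 0 0 0 one_pos le_rfl le_rfl ν hν hT hM hReg hI
  rw [hJ] at h0
  norm_num at h0

/-- **`ZeroCurrentRigidity` is false at the harmonic point.** The statement of the crux
`Summit.AtomisticToContinuum.FouriersLaw.Theses.ParityLiouvilleSeed.ZeroCurrentRigidity`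
(`stmt-AtomisticToContinuum-12073`) with `0 < lam`, `0 < β` relaxed to `0 ≤ lam`, `0 ≤ β` fails,
for the harmonic chain `pinnedChain 1 0 0 0` and its radiating Gaussian state (shift invariant, time
invariant, `IsRegular`, `∫ j₀ = -1/2`). [folklore] -/
theorem zeroCurrentRigidity_false_at_harmonic :
    ¬ (∀ ω₂ lam β γ : ℝ, 0 < ω₂ → 0 ≤ lam → 0 ≤ β → ∀ ν : Measure ChainConfig,
        IsProbabilityMeasure ν → IsShiftInvariant ν → IsTimeInvariant (pinnedChain ω₂ lam β γ) ν →
        IsRegular (pinnedChain ω₂ lam β γ) ν →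
        Integrable (fun σ => (pinnedChain ω₂ lam β γ).bondCurrentZ σ 0) ν →
        ∫ σ, (pinnedChain ω₂ lam β γ).bondCurrentZ σ 0 ∂ν = 0) := by
  intro h
  obtain ⟨ν, hν, hS, hT, -, -, hR, hI, hJ⟩ := harmonic_witness 1 0 one_pos
  have h0 := h 1 0 0 0 one_pos le_rfl le_rfl ν hν hS hT hR hI
  rw [hJ] at h0
  norm_num at h0

/-- **The harmonic chain is not macro-ergodic in the odd sector, quantitatively**: for every
`ω₂ > 0`, `γ`, there is a space-time invariant regular probability measure of `pinnedChain ω₂ 0 0 γ`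
with non-zero mean energy current. [folklore] -/
theorem exists_regular_spaceTime_invariant_current_ne_zero (ω₂ γ : ℝ) (hω : 0 < ω₂) :
    ∃ ν : Measure ChainConfig, IsProbabilityMeasure ν ∧ IsShiftInvariant ν ∧
      IsTimeInvariant (pinnedChain ω₂ 0 0 γ) ν ∧ IsRegular (pinnedChain ω₂ 0 0 γ) ν ∧
      Integrable (fun σ => (pinnedChain ω₂ 0 0 γ).bondCurrentZ σ 0) ν ∧
      ∫ σ, (pinnedChain ω₂ 0 0 γ).bondCurrentZ σ 0 ∂ν ≠ 0 := by
  obtain ⟨ν, hν, hS, hT, -, -, hR, hI, hJ⟩ := harmonic_witness ω₂ γ hω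
  exact ⟨ν, hν, hS, hT, hR, hI, by rw [hJ]; norm_num⟩

end Summit.AtomisticToContinuum.FouriersLaw.Theorems.ParityLiouvilleSeed

end
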